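import Literature.Barriers.AtomisticToContinuum.DisorderedHarmonicChainPhases
import Mathlib.MeasureTheory.Measure.Haar.NormedSpace
import Mathlib.MeasureTheory.Group.Integral
import HarnessLib

/-!
# Ajanki–Huveneers 2011, §2: from random masses to the reduced masses `B_k = (M_k - 𝔼M)/𝔼M`

Fifth file of the Casher–Lebowitz / Ajanki–Huveneers cluster (provefact unit
`AjankiHuveneers2011_spectralScaling`, SIZE XL): the bridge between the mass variables of
`…Transfer.lean` (`MassDensityHyp τ a b`, masses `m : Fin n → ℝ` i.i.d. `∼ τ`, physical frequency
`ω`, `clCurrentDensity`) and the reduced variables of `…Phases.lean` in which §3–§5 of the paper are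
written (`ReducedLawHyp`, `B : ℕ → ℝ`, rescaled frequency `w`, `ahDiag`, `ahPhase`, …). All PROVED:

* `meanMass τ = 𝔼M = ∫ s τ(s) ds ∈ [a, b]`, the reduced density `τ_B(β) = m̄ τ(m̄(1+β))`
  (`reducedDensity`) and **`MassDensityHyp τ a b → ReducedLawHyp τ_B (a/m̄ - 1) (b/m̄ - 1)`**
  (`MassDensityHyp.reducedLawHyp`: support, continuity, `C¹`, bounded derivative, total mass `1`
  and ZERO MEAN, by the affine change of variables);
* the law: `(τ·Leb).map (s ↦ s/m̄ - 1) = τ_B·Leb` (`map_reducedEquiv_withDensity`), a probability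
  measure, and the transport of mass averages `∫ F(m) ρ^{⊗n}(dm) = ∫ F(m̄(1+β)) ρ_B^{⊗n}(dβ)`
  (`integral_pi_eq_integral_pi_reduced`);
* the frequency rescaling `ω = πw/√m̄` under which Dhar's `T_k(ω)` IS the paper's `A_k(w)`:
  `massDiag`/`chainD₁`/`chainD₂` of the masses `m̄(1+B)` at `ω` are `ahDiag`/`ahD (ahDiag w B)` at
  `w` (`massDiag_reduced`, `chainD₁_reduced`, `chainD₂_reduced`, `clCurrentDensity_reduced`).

Source: O. Ajanki, F. Huveneers, CMP 301 (2011) 841–883, arXiv:1003.1076, §2 ¶1–2 ("the zero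
mean random variables `B_k := (M_k - 𝔼M_k)/𝔼M_k` are i.i.d., have a probability density `τ` …";
"`A_k(w) = [[2 - π²w²(1+B_k), -1],[1,0]]`, where the frequency variable `w` is related to the
frequency variable `ω` … by" a fixed positive rescaling — the printed relation carries the
normalisation of Casher–Lebowitz; with `clImpedance`'s `ω` it is `ω = πw/√𝔼M`).

NOT here: the derivation of the bounds (U), (L) of `…Transfer.lean` from the facts of
`…Phases.lean` (§6 of the paper), for which this file is the change of variables.
-/

noncomputable section

open MeasureTheory Real

namespace Literature.Barriers.AtomisticToContinuum.HeatConduction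

/-! ### The mean mass and the reduced density -/

/-- The mean mass `m̄ = 𝔼M = ∫ s τ(s) ds` of the single-mass density `τ`. [cite: AjankiHuveneers2011, §2 ¶1] -/
def meanMass (τ : ℝ → ℝ) : ℝ := ∫ s, s * τ s

/-- The density `τ_B(β) = m̄ τ(m̄(1 + β))` of the reduced mass `B = M/m̄ - 1` when `M ∼ τ(s) ds`.
[cite: AjankiHuveneers2011, §2 ¶1] -/
def reducedDensity (τ : ℝ → ℝ) (β : ℝ) : ℝ := meanMass τ * τ (meanMass τ * (1 + β))

section Bridge

variable {τ : ℝ → ℝ} {a b : ℝ}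

/-- A density of total mass `1` is integrable (no Bochner junk). [folklore] -/
theorem MassDensityHyp.integrable (h : MassDensityHyp τ a b) : Integrable τ := by
  by_contra hn
  have := h.integral_eq_one
  rw [integral_undef hn] at this
  exact zero_ne_one this

/-- `|s τ(s)| ≤ max(|a|,|b|) τ(s)` for a density vanishing off `[a, b]`. [folklore] -/
theorem MassDensityHyp.abs_le (h : MassDensityHyp τ a b) (s : ℝ) :
    |s * τ s| ≤ max |a| |b| * τ s := by
  by_cases hs : s ∈ Set.Icc a b
  · rw [abs_mul, abs_of_nonneg (h.nonneg s)]
    refine mul_le_mul_of_nonneg_right ?_ (h.nonneg s)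
    rcases le_or_gt 0 s with h0 | h0
    · rw [abs_of_nonneg h0]
      exact le_trans (hs.2.trans (le_abs_self b)) (le_max_right _ _)
    · rw [abs_of_neg h0]
      exact le_trans ((neg_le_neg hs.1).trans (neg_le_abs a)) (le_max_left _ _)
  · rw [h.eq_zero s hs]
    simp

/-- `s ↦ s τ(s)` is integrable. [folklore] -/
theorem MassDensityHyp.integrable_mul (h : MassDensityHyp τ a b) :
    Integrable fun s => s * τ s := by
  refine (h.integrable.const_mul (max |a| |b|)).mono' ?_ (ae_of_all _ fun s => ?_)
  · exact (aemeasurable_id.mul h.integrable.aemeasurable).aestronglyMeasurable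
  · rw [Real.norm_eq_abs]
    exact h.abs_le s

/-- `a ≤ 𝔼M`. [folklore] -/
theorem MassDensityHyp.le_meanMass (h : MassDensityHyp τ a b) : a ≤ meanMass τ := by
  have h1 : ∫ s, (s - a) * τ s = meanMass τ - a := by
    simp only [sub_mul]
    rw [integral_sub h.integrable_mul (h.integrable.const_mul a), integral_const_mul,
      h.integral_eq_one, mul_one]
    rfl
  have h2 : 0 ≤ ∫ s, (s - a) * τ s := by
    refine integral_nonneg fun s => ?_
    by_cases hs : s ∈ Set.Icc a b
    · exact mul_nonneg (sub_nonneg.mpr hs.1) (h.nonneg s)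
    · simp [h.eq_zero s hs]
  linarith

/-- `𝔼M ≤ b`. [folklore] -/
theorem MassDensityHyp.meanMass_le (h : MassDensityHyp τ a b) : meanMass τ ≤ b := by
  have h1 : ∫ s, (b - s) * τ s = b - meanMass τ := by
    simp only [sub_mul]
    rw [integral_sub (h.integrable.const_mul b) h.integrable_mul, integral_const_mul,
      h.integral_eq_one, mul_one]
    rfl
  have h2 : 0 ≤ ∫ s, (b - s) * τ s := by
    refine integral_nonneg fun s => ?_
    by_cases hs : s ∈ Set.Icc a b
    · exact mul_nonneg (sub_nonneg.mpr hs.2) (h.nonneg s)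
    · simp [h.eq_zero s hs]
  linarith

/-- `𝔼M > 0`. [folklore] -/
theorem MassDensityHyp.meanMass_pos (h : MassDensityHyp τ a b) : 0 < meanMass τ :=
  h.pos.trans_le h.le_meanMass

/-- **The reduced masses satisfy the standing hypothesis of §2**: if `τ` is an admissible mass
density on `[a, b] ⊂ (0, ∞)` then `τ_B(β) = m̄τ(m̄(1+β))` is an admissible reduced density on
`[a/m̄ - 1, b/m̄ - 1] ⊂ (-1, ∞)` with zero mean (`∫ β τ_B = (1/m̄)∫ s τ - ∫ τ = 0`).
[cite: AjankiHuveneers2011, §2 ¶1] -/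
theorem MassDensityHyp.reducedLawHyp (h : MassDensityHyp τ a b) :
    ReducedLawHyp (reducedDensity τ) (a / meanMass τ - 1) (b / meanMass τ - 1) := by
  have hm := h.meanMass_pos
  set mb := meanMass τ with hmb
  have hmem : ∀ β : ℝ, β ∈ Set.Icc (a / mb - 1) (b / mb - 1) ↔ mb * (1 + β) ∈ Set.Icc a b := by
    intro β
    simp only [Set.mem_Icc]
    rw [div_sub_one hm.ne', div_sub_one hm.ne', div_le_iff₀ hm, le_div_iff₀ hm]
    constructor <;> rintro ⟨h1, h2⟩ <;> constructor <;> nlinarith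
  have hmemo : ∀ β : ℝ, β ∈ Set.Ioo (a / mb - 1) (b / mb - 1) ↔ mb * (1 + β) ∈ Set.Ioo a b := by
    intro β
    simp only [Set.mem_Ioo]
    rw [div_sub_one hm.ne', div_sub_one hm.ne', div_lt_iff₀ hm, lt_div_iff₀ hm]
    constructor <;> rintro ⟨h1, h2⟩ <;> constructor <;> nlinarith
  have haff : ∀ β, HasDerivAt (fun β : ℝ => mb * (1 + β)) mb β := fun β => by
    simpa using ((hasDerivAt_id β).const_add 1).const_mul mb
  obtain ⟨C, hC⟩ := h.deriv_bound
  refine ⟨?_, ?_, ?_, ?_, ?_, ?_, ?_, ?_, ?_⟩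
  · have : 0 < a / mb := div_pos h.pos hm
    linarith
  · have : a / mb < b / mb := div_lt_div_of_pos_right h.lt hm
    linarith
  · intro s
    exact mul_nonneg hm.le (h.nonneg _)
  · intro s hs
    rw [reducedDensity, ← hmb, h.eq_zero _ (mt (hmem s).mpr hs), mul_zero]
  · refine ContinuousOn.mul continuousOn_const (h.continuousOn.comp (by fun_prop) fun β hβ => ?_)
    exact (hmem β).mp hβ
  · refine ContDiffOn.mul contDiffOn_const (h.contDiffOn.comp (by fun_prop) fun β hβ => ?_)
    exact (hmemo β).mp hβ
  · refine ⟨mb * C * mb, fun β hβ => ?_⟩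
    have hy := (hmemo β).mp hβ
    have hdiff : DifferentiableAt ℝ τ (mb * (1 + β)) :=
      (h.contDiffOn.differentiableOn one_ne_zero).differentiableAt (Ioo_mem_nhds hy.1 hy.2)
    have hd : HasDerivAt (reducedDensity τ) (mb * (deriv τ (mb * (1 + β)) * mb)) β := by
      show HasDerivAt (fun β => mb * τ (mb * (1 + β))) _ β
      exact (hdiff.hasDerivAt.comp β (haff β)).const_mul mb
    rw [hd.deriv, ← mul_assoc, abs_mul, abs_mul, abs_of_pos hm]
    exact mul_le_mul_of_nonneg_right (mul_le_mul_of_nonneg_left (hC _ hy) hm.le) hm.le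
  · show ∫ β, mb * τ (mb * (1 + β)) = 1
    rw [integral_const_mul]
    have h1 : ∫ β : ℝ, τ (mb * (1 + β)) = ∫ β : ℝ, (fun y => τ (y + mb)) (mb * β) := by
      congr 1; funext β; ring_nf
    rw [h1, Measure.integral_comp_mul_left (fun y => τ (y + mb)) mb, integral_add_right_eq_self,
      h.integral_eq_one, abs_of_pos (inv_pos.mpr hm), smul_eq_mul, mul_one, mul_inv_cancel₀ hm.ne']
  · show ∫ β, β * (mb * τ (mb * (1 + β))) = 0
    have h1 : ∫ β : ℝ, β * (mb * τ (mb * (1 + β))) =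
        ∫ β : ℝ, (fun y => mb * ((y / mb - 1) * τ (y))) (mb * β + mb) := by
      congr 1; funext β
      have : (mb * β + mb) / mb - 1 = β := by field_simp; ring
      simp only []
      rw [this, show mb * β + mb = mb * (1 + β) by ring]
      ring
    have h2 : ∫ β : ℝ, (fun y => mb * ((y / mb - 1) * τ y)) (mb * β + mb) =
        ∫ β : ℝ, (fun z => (fun y => mb * ((y / mb - 1) * τ y)) (z + mb)) (mb * β) := rfl
    rw [h1, h2, Measure.integral_comp_mul_left (fun z => mb * (((z + mb) / mb - 1) * τ (z + mb))) mb]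
    rw [integral_add_right_eq_self (fun y => mb * ((y / mb - 1) * τ y)) mb, integral_const_mul]
    have h3 : ∫ y, (y / mb - 1) * τ y = 0 := by
      have : (fun y => (y / mb - 1) * τ y) = fun y => mb⁻¹ * (y * τ y) - τ y := by
        funext y; field_simp
      rw [this, integral_sub (h.integrable_mul.const_mul _) h.integrable, integral_const_mul,
        h.integral_eq_one]
      show mb⁻¹ * meanMass τ - 1 = 0
      rw [← hmb, inv_mul_cancel₀ hm.ne', sub_self]
    simp [h3]

/-! ### The reduced law as a push-forward -/

/-- The affine measurable equivalence `s ↦ s/m̄ - 1` (`M ↦ B`) of `ℝ`. [cite: AjankiHuveneers2011, §2 ¶1] -/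
def reducedEquiv (mb : ℝ) (hm : mb ≠ 0) : ℝ ≃ᵐ ℝ :=
  ((Homeomorph.mulLeft₀ mb⁻¹ (inv_ne_zero hm)).trans (Homeomorph.addRight (-1))).toMeasurableEquiv

/-- `reducedEquiv m̄ s = s/m̄ - 1`. [folklore] -/
theorem reducedEquiv_apply (mb : ℝ) (hm : mb ≠ 0) (s : ℝ) : reducedEquiv mb hm s = s / mb - 1 := by
  simp [reducedEquiv, div_eq_inv_mul, sub_eq_add_neg]

/-- `(reducedEquiv m̄)⁻¹ β = m̄(1 + β)`. [folklore] -/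
theorem reducedEquiv_symm_apply (mb : ℝ) (hm : mb ≠ 0) (β : ℝ) :
    (reducedEquiv mb hm).symm β = mb * (1 + β) := by
  have h1 : (Homeomorph.addRight (-1 : ℝ)).symm β = β + 1 := by
    rw [Homeomorph.addRight_symm]
    simp
  simp [reducedEquiv, Homeomorph.mulLeft₀_symm_apply, h1]
  left
  ring

/-- Lebesgue measure under `s ↦ s/m̄ - 1` is `m̄ ·` Lebesgue. [folklore] -/
theorem map_volume_reducedEquiv (mb : ℝ) (hm : 0 < mb) :
    Measure.map (reducedEquiv mb hm.ne') volume = ENNReal.ofReal mb • (volume : Measure ℝ) := by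
  have h1 : (reducedEquiv mb hm.ne' : ℝ → ℝ) = (fun x : ℝ => x + (-1)) ∘ (fun x : ℝ => mb⁻¹ * x) := by
    funext s
    simp [reducedEquiv_apply, div_eq_inv_mul, sub_eq_add_neg]
  rw [h1, ← Measure.map_map (measurable_add_const _) (measurable_const_mul _),
    Real.map_volume_mul_left (inv_ne_zero hm.ne'), Measure.map_smul, map_add_right_eq_self,
    inv_inv, abs_of_pos hm]

/-- **The law of the reduced mass**: if `M ∼ τ(s) ds` then `B = M/m̄ - 1 ∼ τ_B(β) dβ`,
`τ_B(β) = m̄ τ(m̄(1+β))`. [cite: AjankiHuveneers2011, §2 ¶1] -/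
theorem map_reducedEquiv_withDensity {τ : ℝ → ℝ} {a b : ℝ} (h : MassDensityHyp τ a b) :
    Measure.map (reducedEquiv (meanMass τ) h.meanMass_pos.ne')
        (volume.withDensity fun s => ENNReal.ofReal (τ s)) =
      volume.withDensity fun β => ENNReal.ofReal (reducedDensity τ β) := by
  have hm := h.meanMass_pos
  set e := reducedEquiv (meanMass τ) hm.ne' with he
  -- generic transport of `withDensity` along a measurable equivalence
  have hgen : ∀ (F : ℝ → ENNReal), Measure.map e (volume.withDensity F) =
      (Measure.map e volume).withDensity (F ∘ e.symm) := by
    intro F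
    ext s hs
    rw [Measure.map_apply e.measurable hs, withDensity_apply _ (e.measurable hs),
      withDensity_apply _ hs, Measure.restrict_map e.measurable hs, lintegral_map_equiv]
    simp only [Function.comp_apply, e.symm_apply_apply]
  rw [hgen, he, map_volume_reducedEquiv _ hm, withDensity_smul_measure,
    ← withDensity_smul' _ _ ENNReal.ofReal_ne_top]
  congr 1
  funext β
  simp only [Pi.smul_apply, smul_eq_mul, Function.comp_apply, reducedEquiv_symm_apply,
    reducedDensity]
  rw [← ENNReal.ofReal_mul hm.le]

/-- The reduced law is a probability measure. [folklore] -/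
theorem isProbabilityMeasure_map_reducedEquiv {τ : ℝ → ℝ} {a b : ℝ} (h : MassDensityHyp τ a b)
    (ρ : Measure ℝ) [IsProbabilityMeasure ρ] :
    IsProbabilityMeasure (Measure.map (reducedEquiv (meanMass τ) h.meanMass_pos.ne') ρ) :=
  Measure.isProbabilityMeasure_map (reducedEquiv _ _).measurable.aemeasurable

/-- **Transport of mass averages to the reduced variables**: for every `F`,
`∫ F(m) ρ^{⊗n}(dm) = ∫ F(m̄(1+β_·)) ρ_B^{⊗n}(dβ)` with `ρ_B` the push-forward law (the product of
the measure-preserving maps `β ↦ m̄(1+β)`). [folklore] -/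
theorem integral_pi_eq_integral_pi_reduced {τ : ℝ → ℝ} {a b : ℝ} (h : MassDensityHyp τ a b)
    (ρ : Measure ℝ) [IsProbabilityMeasure ρ] (n : ℕ) (F : (Fin n → ℝ) → ℝ) :
    ∫ m, F m ∂(Measure.pi fun _ : Fin n => ρ) =
      ∫ β, F (fun k => meanMass τ * (1 + β k))
        ∂(Measure.pi fun _ : Fin n => Measure.map (reducedEquiv (meanMass τ) h.meanMass_pos.ne') ρ) := by
  have hm := h.meanMass_pos
  set e := reducedEquiv (meanMass τ) hm.ne' with he
  haveI : IsProbabilityMeasure (Measure.map e ρ) := isProbabilityMeasure_map_reducedEquiv h ρ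
  have h1 : MeasurePreserving e ρ (Measure.map e ρ) := ⟨e.measurable, rfl⟩
  have h2 : MeasurePreserving e.symm (Measure.map e ρ) ρ := h1.symm e
  have h3 := measurePreserving_pi (fun _ : Fin n => Measure.map e ρ) (fun _ : Fin n => ρ)
    (f := fun _ => e.symm) (fun _ => h2)
  have h4 := h3.integral_comp (MeasurableEquiv.piCongrRight fun _ : Fin n => e.symm).measurableEmbedding F
  rw [← h4]
  congr 1
  funext β
  congr 1
  funext k
  exact reducedEquiv_symm_apply _ _ _

/-! ### From masses and `ω` to reduced masses and `w` -/

/-- `m_kω² = π²w²(1 + B_k)` for `m_k = m̄(1 + B_k)`, `ω = πw/√m̄`: the diagonal symbols of Dhar's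
`T_k(ω)` and of the paper's `A_k(w)` agree along the chain.
[cite: AjankiHuveneers2011, §2 eq. (2.1)] -/
theorem massDiag_reduced {n : ℕ} (mb : ℝ) (hm : 0 < mb) (β : Fin n → ℝ) (w : ℝ) {j : ℕ}
    (hj : j < n) :
    massDiag (fun k => mb * (1 + β k)) (π * w / Real.sqrt mb) j = ahDiag w (finExt β) j := by
  rw [massDiag, finExt_of_lt _ hj, ahDiag_apply, finExt_of_lt _ hj, div_pow, Real.sq_sqrt hm.le]
  field_simp

/-- `D_j(e₁)` of the mass chain at `ω = πw/√m̄` is `D_j(e₁)` of the reduced chain at `w` (`j ≤ n`).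
[cite: AjankiHuveneers2011, §2 eq. (2.1) and §2.1 eq. (2.2)] -/
theorem chainD₁_reduced {n : ℕ} (mb : ℝ) (hm : 0 < mb) (β : Fin n → ℝ) (w : ℝ) {j : ℕ}
    (hj : j ≤ n) :
    chainD₁ (fun k => mb * (1 + β k)) (π * w / Real.sqrt mb) j = ahD (ahDiag w (finExt β)) 1 0 j :=
  ahD_congr 1 0 j fun k hk => massDiag_reduced mb hm β w (by omega)

/-- `D_j(e₂)` of the mass chain at `ω = πw/√m̄` is `D_j(e₂)` of the reduced chain at `w` (`j ≤ n`).
[cite: AjankiHuveneers2011, §2 eq. (2.1) and §2.1 eq. (2.2)] -/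
theorem chainD₂_reduced {n : ℕ} (mb : ℝ) (hm : 0 < mb) (β : Fin n → ℝ) (w : ℝ) {j : ℕ}
    (hj : j ≤ n) :
    chainD₂ (fun k => mb * (1 + β k)) (π * w / Real.sqrt mb) j = ahD (ahDiag w (finExt β)) 0 1 j :=
  ahD_congr 0 1 j fun k hk => massDiag_reduced mb hm β w (by omega)

/-- The current density of the mass chain in the reduced variables: with `ω = πw/√m̄`,
`j_n(ω; m̄(1+B)) = ω²/(2ω² + D_n(e₁)² + ω²(D_{n-1}(e₁)² + D_n(e₂)²) + ω⁴D_{n-1}(e₂)²)` with the `D`'s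
of the reduced chain `ahD (ahDiag w B)`. [cite: AjankiHuveneers2011, §2.1 eq. (2.7)] -/
theorem clCurrentDensity_reduced {k : ℕ} (mb : ℝ) (hm : 0 < mb) (β : Fin (k + 1) → ℝ) (w : ℝ) :
    clCurrentDensity (fun i => mb * (1 + β i)) (π * w / Real.sqrt mb) =
      (π * w / Real.sqrt mb) ^ 2 / (2 * (π * w / Real.sqrt mb) ^ 2 +
        ahD (ahDiag w (finExt β)) 1 0 (k + 1) ^ 2 +
        (π * w / Real.sqrt mb) ^ 2 * (ahD (ahDiag w (finExt β)) 1 0 k ^ 2 +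
          ahD (ahDiag w (finExt β)) 0 1 (k + 1) ^ 2) +
        (π * w / Real.sqrt mb) ^ 4 * ahD (ahDiag w (finExt β)) 0 1 k ^ 2) := by
  rw [clCurrentDensity_succ, chainD₁_reduced mb hm β w le_rfl, chainD₁_reduced mb hm β w (by omega),
    chainD₂_reduced mb hm β w le_rfl, chainD₂_reduced mb hm β w (by omega)]

end Bridge

end Literature.Barriers.AtomisticToContinuum.HeatConduction

end
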